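import Literature.IUT.HodgeTheaters.KitCoreBridge
import Mathlib.CategoryTheory.Products.Basic
import Mathlib.CategoryTheory.SingleObj
import HarnessLib

/-!
# `KitCore(K, 𝔡)` is consistent: every §6 base kit, thickened by free endomorphisms, core-agrees with a
# §4 datum whose Example-4.4 poly-morphisms are the kit's (KIT-RULE inhabitant of `KitCore` + `ThetaAgrees`)

S. Mochizuki, *Inter-universal Teichmüller theory I*, kurims manuscript (May 2020), Def 4.1 (i) p. 95, Def 6.1
(i) p. 156, Example 4.4 (i), (ii), (iv) pp. 105–107 ([IUTchI] Ex 4.4 (iv) p.107)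
[claim: Mochizuki2012, status: disputed] (D-0012 claim key; CONSISTENCY MODEL for the bridge structure
`BaseThetaDatum.KitCore` / `KitCore.ThetaAgrees` of `KitCoreBridge.lean` — nothing of the series is asserted,
no side is taken on [IUTchIII] Cor. 3.12).

The cell's KIT-RULE asks that every hypothesis structure be shown inhabited, so that no theorem over it is
vacuous.  The tree's toy kits (`PMBaseKit.toyKit`: `Aut(𝒟_v) = End(𝒟_v) = {±1}`) cannot host the Example-4.4
structure of a §4 datum (which needs `l^⋇ + 1 ≥ 3` pairwise disjoint, nonempty, iso-bi-saturated families of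
endomorphisms of `𝒟_v` — the evaluation sections of the labels `∈ |𝔽_l|`).  This file therefore proves a
GENERAL consistency statement:

* `PMBaseKit.thicken K` — any base kit `K` (universe `0`) with its ambient categories replaced by
  `K.Amb v × (one object, endomorphism monoid (ℕ, +))`: every field of abc-iut-L5-t4's `PMBaseKit` transfers
  along the first projection (isomorphisms of the product have trivial second component), so the thickening
  IS again a base kit;
* `PMBaseKit.thickDatum K` — over the thickened kit (given `𝕍^bad ∩ 𝕍^arc = ∅`, `𝕍^bad ≠ ∅`, `l ≥ 5`), an
  inhabitant of abc-iut-L5-t3's `BaseThetaDatum` whose ambient categories are the full subcategories of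
  isomorphs of the models, whose label torsors are `𝔽_l^⋇` acting on itself, and whose evaluation sections of
  label `j ∈ |𝔽_l|` are the morphisms with second component `|j| + 1` (all ≈ 55 axioms kernel-checked);
* `PMBaseKit.thickCore K` — the core agreement `KitCore` between them with `e = id` (so indexed by ALL of
  `𝕍`), the comparison functors being the (fully faithful) inclusions of the full subcategories, and
  `PMBaseKit.thickMultKit K` — a multiplicative kit whose `thetaPolyBad` are, by construction, the datum's
  Example-4.4 poly-morphisms, so that `ThetaAgrees` holds (`thickCore_thetaAgrees`);
* `exists_kitCore_thetaAgrees` — packaged: for every prime `l ≥ 5` there are `𝔡`, `K`, `M`, `c` with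
  `c.ThetaAgrees M`, `c.e` bijective and `𝕍^bad ≠ ∅`; hence (`KitCore.gluingUnique_of_surjective`) the derived
  law and its consequences of `KitCoreBridge.lean` are NON-VACUOUS.

Consistency/plumbing only; every `theorem` is kernel-checked. typed ≠ proved elsewhere.
-/

namespace Literature.IUT.HodgeTheaters

open CategoryTheory

namespace PMBaseKit

/-! ### The thickening monoid category -/

/-- The thickening category: one object whose endomorphism monoid is `(ℕ, +)` — only `0` is invertible, every
other endomorphism is a "non-isomorphism" available to play an evaluation section (model plumbing for
[IUTchI] Ex 4.4 (i) p. 105). ([IUTchI] Ex 4.4 (i) p.105) [claim: Mochizuki2012, status: disputed] -/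
abbrev Thick : Type := SingleObj (Multiplicative ℕ)

/-- The object of the thickening category. (model plumbing for [IUTchI] Ex 4.4 (i) p. 105) ([IUTchI] Ex 4.4 (i) p.105) [claim: Mochizuki2012, status: disputed] -/
abbrev Thick.pt : Thick := SingleObj.star (Multiplicative ℕ)

/-- The element of `(ℕ, +)` underlying a morphism of the thickening category. (model plumbing) ([IUTchI] Ex 4.4 (i) p.105) [claim: Mochizuki2012, status: disputed] -/
abbrev Thick.val {X Y : Thick} (f : X ⟶ Y) : Multiplicative ℕ := f

/-- In the thickening category every isomorphism is the identity element (`ℕ` has no units but `0`).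
(model plumbing) ([IUTchI] Ex 4.4 (i) p.105) [claim: Mochizuki2012, status: disputed] -/
theorem Thick.val_iso_hom {X Y : Thick} (a : X ≅ Y) : Thick.val a.hom = 1 := by
  have h : Thick.val a.inv * Thick.val a.hom = 1 := a.hom_inv_id
  have h' : Multiplicative.toAdd (Thick.val a.inv) + Multiplicative.toAdd (Thick.val a.hom) = 0 :=
    congrArg Multiplicative.toAdd h
  have : Multiplicative.toAdd (Thick.val a.hom) = 0 := by omega
  exact congrArg Multiplicative.ofAdd this

variable {l : ℕ}

/-! ### Thickening a base kit -/

/-- **Thickening a base kit.** The base kit with ambient categories `K.Amb v × Thick` and models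
`(𝒟_v, pt)`; every other per-place field of abc-iut-L5-t4's `PMBaseKit` ([IUTchI] Def 6.1 (ii)–(vii)) is
read through the first projection, the global fields are unchanged.  (Consistency plumbing: the extra
endomorphisms make room for the evaluation sections of a §4 datum, [IUTchI] Ex 4.4 (i).)
([IUTchI] Def 6.1 p.156) [claim: Mochizuki2012, status: disputed] -/
noncomputable def thicken (K : PMBaseKit.{0} l) : PMBaseKit.{0} l where
  V := K.V
  bad := K.bad
  arc := K.arc
  Amb x := K.Amb x × Thick
  model x := (K.model x, Thick.pt)
  pmObj x X := (K.pmObj x X.1, X.2)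
  toPM x X := (K.toPM x X.1, 𝟙 X.2)
  LabCuspPM x X := K.LabCuspPM x X.1
  labPM x X hX := K.labPM x X.1 ⟨(CategoryTheory.Prod.fst _ _).mapIso hX.some⟩
  labMap x := fun φ => K.labMap x ((CategoryTheory.Prod.fst _ _).mapIso φ)
  labMap_refl x X := by
    rw [Functor.mapIso_refl]
    exact K.labMap_refl x X.1
  labMap_trans x := fun φ ψ => by
    rw [Functor.mapIso_trans]
    exact K.labMap_trans x _ _
  labMap_charts x := fun hX hY φ e he => K.labMap_charts x _ _ ((CategoryTheory.Prod.fst _ _).mapIso φ) e he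
  exists_negative x X hX := by
    obtain ⟨α, hα⟩ := K.exists_negative x X.1 ⟨(CategoryTheory.Prod.fst _ _).mapIso hX.some⟩
    refine ⟨Iso.prod α (Iso.refl X.2), ?_⟩
    have h : (CategoryTheory.Prod.fst _ _).mapIso (Iso.prod α (Iso.refl X.2)) = α := by ext; rfl
    rw [h]
    exact hα
  Glob := K.Glob
  gModel := K.gModel
  gIso := K.gIso
  GLab := K.GLab
  gLabMap := K.gLabMap
  gLabMap_refl := K.gLabMap_refl
  gLabMap_trans := K.gLabMap_trans
  toFlStar := K.toFlStar
  toFlStar_surjective := K.toFlStar_surjective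
  gLabT := K.gLabT
  gChart₀ := K.gChart₀
  gChart₀_mem := K.gChart₀_mem
  autCsp_le := K.autCsp_le
  gLab_range := K.gLab_range
  atV x := (K.atV x).prod' ((Functor.const K.Glob).obj Thick.pt)
  phiEll x := (K.phiEll x, 𝟙 Thick.pt)
  labOfHom x := fun f => K.labOfHom x f.1
  labOfHom_pre x := fun φ f => K.labOfHom_pre x ((CategoryTheory.Prod.fst _ _).mapIso φ) f.1
  labOfHom_post x := fun f ψ => K.labOfHom_post x f.1 ψ
  labOfHom_phiEll_bijective x := K.labOfHom_phiEll_bijective x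
  labOfHom_phiEll_charts x e he := K.labOfHom_phiEll_charts x e he

/-- The thickened kit has the same places. ([IUTchI] Def 6.1 p.156) [claim: Mochizuki2012, status: disputed] -/
theorem thicken_V (K : PMBaseKit.{0} l) : K.thicken.V = K.V := rfl

/-- The thickened kit has the same bad places. ([IUTchI] Def 6.1 p.156) [claim: Mochizuki2012, status: disputed] -/
theorem thicken_bad (K : PMBaseKit.{0} l) : K.thicken.bad = K.bad := rfl

/-- For an isomorphism of the thickened ambient category between isomorphs of the model, the second
component is trivial. (model plumbing) ([IUTchI] Ex 4.4 (i) p.105) [claim: Mochizuki2012, status: disputed] -/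
theorem thicken_val_iso_hom (K : PMBaseKit.{0} l) {x : K.V} {X Y : ObjectProperty.FullSubcategory (K.thicken.IsLocal x)}
    (a : X ≅ Y) :
    Thick.val a.hom.hom.2 = 1 :=
  Thick.val_iso_hom ((CategoryTheory.Prod.snd _ _).mapIso ((ObjectProperty.ι (K.thicken.IsLocal x)).mapIso a))

/-! ### A §4 datum over the thickened kit -/

namespace ThickModel

variable (l)

/-- The global ambient category of the model datum: one object with automorphism group `𝔽_l^⋇`.
(model plumbing, as in abc-iut-L5-t3's `BaseThetaDatum.trivialModel`) ([IUTchI] Def 4.1 (v) p.97) [claim: Mochizuki2012, status: disputed] -/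
abbrev GlobAmb : Type := SingleObj (FlStar l)

/-- The element of `𝔽_l^⋇` underlying a morphism of the global ambient category. (model plumbing) ([IUTchI] Def 4.1 (v) p.97) [claim: Mochizuki2012, status: disputed] -/
abbrev gval {Y Y' : GlobAmb l} (f : Y ⟶ Y') : FlStar l := f

/-- The automorphism of the global object given by a group element. (model plumbing) ([IUTchI] Ex 4.3 (i) p.98) [claim: Mochizuki2012, status: disputed] -/
def globIso (g : FlStar l) : (SingleObj.star (FlStar l) : GlobAmb l) ≅ SingleObj.star (FlStar l) where
  hom := g
  inv := (g⁻¹ : FlStar l)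
  hom_inv_id := inv_mul_cancel g
  inv_hom_id := mul_inv_cancel g

end ThickModel

open ThickModel in
/-- **A §4 datum over the thickened kit** (KIT-RULE inhabitant of abc-iut-L5-t3's `BaseThetaDatum` shaped on a
given §6 kit): places, bad and archimedean places those of `K` (assumed disjoint, `𝕍^bad ≠ ∅`, `l ≥ 5` as in
Def 3.1 (b), (c), (e)); ambient category at `v` = the full subcategory of the thickened ambient category on the
isomorphs of the model (Def 4.1 (i)); model `(𝒟_v, pt)`; mono-analyticisation the identity; global ambient
category one object with automorphisms `𝔽_l^⋇`; all label torsors `𝔽_l^⋇` acting on itself; `φ^NF`-type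
morphisms `𝔽_l^⋇`; the evaluation sections of label `j ∈ |𝔽_l|` (Ex 4.4 (i)) are the morphisms whose
thickening component is `|j| + 1` — never an isomorphism, closed under composition with isomorphisms (their
thickening component is `0`), labels well defined.  Every axiom is checked by the kernel.
([IUTchI] Def 4.1 (i) p.95) [claim: Mochizuki2012, status: disputed] -/
noncomputable def thickDatum (K : PMBaseKit.{0} l) [Fact l.Prime] (hl5 : 5 ≤ l)
    (hdis : Disjoint K.bad K.arc) (hbad : K.bad.Nonempty) : BaseThetaDatum.{0} where
  l := l
  five_le_l := hl5
  V := K.V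
  IsArc x := x ∈ K.arc
  IsBad x := x ∈ K.bad
  not_isArc_of_isBad hx ha := Finset.disjoint_left.mp hdis hx ha
  exists_isBad := hbad
  Amb x := ObjectProperty.FullSubcategory (K.thicken.IsLocal x)
  D x := ⟨K.thicken.model x, K.thicken.isLocal_model x⟩
  nonempty_iso x X Y := ⟨ObjectProperty.isoMk _ (X.property.some ≪≫ Y.property.some.symm)⟩
  AmbM x := ObjectProperty.FullSubcategory (K.thicken.IsLocal x)
  DM x := ⟨K.thicken.model x, K.thicken.isLocal_model x⟩
  nonempty_isoM x X Y := ⟨ObjectProperty.isoMk _ (X.property.some ≪≫ Y.property.some.symm)⟩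
  mono _ X := X
  monoIso f := f
  monoIso_refl _ := rfl
  monoIso_trans _ _ := rfl
  AmbG := GlobAmb l
  DG := SingleObj.star _
  nonempty_isoG X Y := ⟨Iso.refl _⟩
  Val _ := K.V
  valIso _ := Equiv.refl _
  valIso_refl _ := rfl
  valIso_trans _ _ := rfl
  valOfV := Function.Embedding.refl _
  HomNF _ _ _ := FlStar l
  preNF _ f := f
  postNF f b := f * gval l b.hom
  preNF_refl _ := rfl
  preNF_trans _ _ _ := rfl
  postNF_refl f := mul_one f
  postNF_trans f b b' := by
    change f * (gval l b'.hom * gval l b.hom) = f * gval l b.hom * gval l b'.hom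
    rw [mul_assoc]
    exact congrArg (f * ·) (mul_comm (gval l b'.hom) (gval l b.hom))
  preNF_postNF _ _ _ := rfl
  phiNF _ := 1
  exists_eq_phiNF := fun {x X Y} f => ⟨ObjectProperty.isoMk _ X.property.some, globIso l f, (one_mul f).symm⟩
  LabCusp _ _ := FlStar l
  isTorsor_labCusp _ _ := IsTorsor.self
  labIso _ := Equiv.refl _
  labIso_smul _ _ _ := rfl
  labIso_refl _ := rfl
  labIso_trans _ _ := rfl
  η _ _ := 1
  labIso_η _ := rfl
  LabCuspG _ := FlStar l
  isTorsor_labCuspG _ := IsTorsor.self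
  labIsoG b := Equiv.mulRight (gval l b.hom)⁻¹
  labIsoG_smul b j c := mul_assoc j c _
  labIsoG_refl Y := by
    ext c; change c * (1 : FlStar l)⁻¹ = c; rw [inv_one, mul_one]
  labIsoG_trans b b' := by
    ext c
    change c * (gval l b'.hom * gval l b.hom)⁻¹ = c * (gval l b.hom)⁻¹ * (gval l b'.hom)⁻¹
    rw [mul_inv_rev, mul_assoc]
  εLab := 1
  exists_aut_smul j := ⟨globIso l j⁻¹, fun c => by
    change c * (j⁻¹)⁻¹ = j * c
    rw [inv_inv]
    exact mul_comm c j⟩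
  labPull f := Equiv.mulRight f
  labPull_smul f j c := mul_assoc j c f
  labPull_preNF _ _ _ := rfl
  labPull_postNF f b c := by
    change c * (f * gval l b.hom) = (Equiv.mulRight (gval l b.hom)⁻¹).symm c * f
    rw [Equiv.mulRight_symm_apply, inv_inv, mul_assoc]
    exact congrArg (c * ·) (mul_comm f (gval l b.hom))
  labPull_phiNF_εLab _ := mul_one 1
  IsEvalSection _ j _ _ f := Thick.val f.hom.2 = Multiplicative.ofAdd (FlAbs.absVal l j + 1)
  isEvalSection_isoComp _ j _ _ _ a f hf := by
    change Thick.val f.hom.2 * Thick.val a.hom.hom.2 = _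
    rw [K.thicken_val_iso_hom a, mul_one]
    exact hf
  isEvalSection_compIso _ j _ _ _ f b hf := by
    change Thick.val b.hom.hom.2 * Thick.val f.hom.2 = _
    rw [K.thicken_val_iso_hom b, one_mul]
    exact hf
  exists_isEvalSection _ j X Y :=
    ⟨ObjectProperty.homMk (Prod.mkHom (X.property.some ≪≫ Y.property.some.symm).hom.1
        (Multiplicative.ofAdd (FlAbs.absVal l j + 1) : Multiplicative ℕ)), rfl⟩
  isEvalSection_label_unique _ j j' _ _ f h h' := by
    have h1 := h.symm.trans h'
    have h2 := Multiplicative.ofAdd.injective h1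
    exact FlAbs.absVal_injective l (by omega)

/-- The prime of the model datum is `l`. ([IUTchI] Def 3.1 (c) p.61) [claim: Mochizuki2012, status: disputed] -/
theorem thickDatum_l (K : PMBaseKit.{0} l) [Fact l.Prime] (hl5 : 5 ≤ l) (hdis : Disjoint K.bad K.arc) (hbad : K.bad.Nonempty) :
    (K.thickDatum hl5 hdis hbad).l = l := rfl

/-! ### The core agreement and a multiplicative kit that agrees -/

/-- **`KitCore` is inhabited**: the thickened kit core-agrees with the datum `thickDatum` — SAME index set
(`e = id`, so the kit is indexed by all of `𝕍`), same bad / archimedean places, comparison functor = the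
fully faithful inclusion of the full subcategory of isomorphs of the model, model to model by the identity.
([IUTchI] Def 6.1 (i) p.156) [claim: Mochizuki2012, status: disputed] -/
noncomputable def thickCore (K : PMBaseKit.{0} l) [Fact l.Prime] (hl5 : 5 ≤ l) (hdis : Disjoint K.bad K.arc)
    (hbad : K.bad.Nonempty) : (K.thickDatum hl5 hdis hbad).KitCore K.thicken where
  e := Function.Embedding.refl _
  mem_bad_iff _ := Iff.rfl
  mem_arc_iff _ := Iff.rfl
  amb x := ObjectProperty.ι (K.thicken.IsLocal x)
  ambFF x := ObjectProperty.fullyFaithfulι (K.thicken.IsLocal x)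
  ambModel _ := Iso.refl _

/-- The comparison of index sets of `thickCore` is a bijection (the identity). ([IUTchI] Def 6.1 (i) p.156) [claim: Mochizuki2012, status: disputed] -/
theorem thickCore_e_bijective (K : PMBaseKit.{0} l) [Fact l.Prime] (hl5 : 5 ≤ l) (hdis : Disjoint K.bad K.arc)
    (hbad : K.bad.Nonempty) : Function.Bijective (K.thickCore hl5 hdis hbad).e :=
  Function.bijective_id

/-- **A multiplicative kit whose Example-4.4 poly-morphisms are the datum's** (Prop 6.7: "the poly-morphisms
described … in Example 4.4, (i), (ii)"): `thetaPolyBad j v` := Example 4.4's `φ^Θ_{v_j}` of `thickDatum` for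
the label `ofFin j`, read in the kit (mono-analyticisation trivial). ([IUTchI] Prop 6.7 p.167) [claim: Mochizuki2012, status: disputed] -/
noncomputable def thickMultKit (K : PMBaseKit.{0} l) [Fact l.Prime] (hl5 : 5 ≤ l) (hdis : Disjoint K.bad K.arc)
    (hbad : K.bad.Nonempty) : K.thicken.MultKit where
  DMono := SingleObj Unit
  mono _ := SingleObj.star _
  monoMap _ := 𝟙 _
  thetaPolyBad j x _ :=
    {g | ∃ f ∈ (K.thickDatum hl5 hdis hbad).phiThetaAt (FlStar.ofFin l j) x
        ((K.thickDatum hl5 hdis hbad).D x) ((K.thickDatum hl5 hdis hbad).D x),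
      g = ((K.thickCore hl5 hdis hbad).ambModel x).inv ≫ ((K.thickCore hl5 hdis hbad).amb x).map f ≫
        ((K.thickCore hl5 hdis hbad).ambModel x).hom}

/-- **`ThetaAgrees` is inhabited**: the multiplicative kit `thickMultKit` agrees with the datum through
`thickCore` (by construction). ([IUTchI] Prop 6.7 p.167) [claim: Mochizuki2012, status: disputed] -/
theorem thickCore_thetaAgrees (K : PMBaseKit.{0} l) [Fact l.Prime] (hl5 : 5 ≤ l) (hdis : Disjoint K.bad K.arc)
    (hbad : K.bad.Nonempty) : (K.thickCore hl5 hdis hbad).ThetaAgrees (K.thickMultKit hl5 hdis hbad) :=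
  fun _ _ _ => rfl

/-- **In the model, the derived law and Rmk 6.12.2 (ii) apply outright**: for every `ℱ`-kit and ΘNF-side kit
over the thickened kit with the agreeing multiplicative kit, `GluingUnique` holds (an instance of
`KitCore.gluingUnique_of_surjective`; shows the chain of `KitCoreBridge.lean` composes on an inhabitant).
([IUTchI] Rmk 6.12.2 (ii) p.174) [claim: Mochizuki2012, status: disputed] -/
theorem thick_gluingUnique (K : PMBaseKit.{0} l) [Fact l.Prime] (hl5 : 5 ≤ l) (hdis : Disjoint K.bad K.arc) (hbad : K.bad.Nonempty)
    {FK : K.thicken.FKit (K.thickMultKit hl5 hdis hbad)} (N : K.thicken.S5Local _ FK) :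
    N.GluingUnique (K.thickDatum hl5 hdis hbad).odd_l :=
  BaseThetaDatum.KitCore.gluingUnique_of_surjective (K.thickCore_thetaAgrees hl5 hdis hbad)
    (K.thickCore_e_bijective hl5 hdis hbad).2 _ N

/-! ### Packaged existence -/

/-- **KIT-RULE for `KitCore` + `ThetaAgrees`**: for every prime `l ≥ 5` there exist a §4 datum `𝔡` with
`𝔡.l = l`, a §6 base kit `K` for `𝔡.l`, a multiplicative kit `M` and a core agreement `c : KitCore 𝔡 K` with
`c.ThetaAgrees M`, `c.e` bijective and `𝕍^bad ≠ ∅` — built from abc-iut-L5-t4's toy kit with one (bad)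
place, thickened.  So the derived label-rigidity law of `KitCoreBridge.lean` and its consequences are not
vacuous. ([IUTchI] Ex 4.4 (iv) p.107) [claim: Mochizuki2012, status: disputed] -/
theorem exists_kitCore_thetaAgrees (l : ℕ) [Fact l.Prime] (hl5 : 5 ≤ l) :
    ∃ (𝔡 : BaseThetaDatum.{0}) (K : PMBaseKit.{0} 𝔡.l) (M : K.MultKit) (c : 𝔡.KitCore K),
      𝔡.l = l ∧ c.ThetaAgrees M ∧ Function.Bijective c.e ∧ K.bad.Nonempty := by
  classical
  have hl2 : l ≠ 2 := by omega
  let K : PMBaseKit.{0} l := { toyKit l hl2 with bad := ({PUnit.unit} : Finset Unit), arc := ∅ }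
  have hdis : Disjoint K.bad K.arc := Finset.disjoint_empty_right _
  have hbad : K.bad.Nonempty := ⟨PUnit.unit, Finset.mem_singleton_self _⟩
  exact ⟨K.thickDatum hl5 hdis hbad, K.thicken, K.thickMultKit hl5 hdis hbad, K.thickCore hl5 hdis hbad,
    rfl, K.thickCore_thetaAgrees hl5 hdis hbad, K.thickCore_e_bijective hl5 hdis hbad, hbad⟩

/-- The KIT-RULE witness at `l = 5`. ([IUTchI] Ex 4.4 (iv) p.107) [claim: Mochizuki2012, status: disputed] -/
theorem exists_kitCore_thetaAgrees_five :
    ∃ (𝔡 : BaseThetaDatum.{0}) (K : PMBaseKit.{0} 𝔡.l) (M : K.MultKit) (c : 𝔡.KitCore K),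
      𝔡.l = 5 ∧ c.ThetaAgrees M ∧ Function.Bijective c.e ∧ K.bad.Nonempty :=
  haveI : Fact (Nat.Prime 5) := ⟨Nat.prime_five⟩
  exists_kitCore_thetaAgrees 5 le_rfl

end PMBaseKit

end Literature.IUT.HodgeTheaters
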